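import Summits.BirchSwinnertonDyer.Rank1Residual.P2.CongruentNumberSilentEvenFiveEnclosureRungTwo
import Summits.BirchSwinnertonDyer.Rank1Residual.P2.CongruentNumberSilentEvenFiveEnclosureAokiBridged
import Summits.BirchSwinnertonDyer.Rank1Residual.P2.CongruentNumberSilentEvenFiveThetaCMClassField
import Summits.BirchSwinnertonDyer.Rank1Residual.P2.CongruentNumberEvenMonskyLawDescent
import Summits.BirchSwinnertonDyer.Rank1Residual.P2.CongruentNumberSilentEvenFiveSelmerEight
import Literature.NumberTheory.EllipticCurves.CongruentNumberEvenMonskySelmerExact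
import HarnessLib

/-!
# Cell «bsd-monsky» (typer): THE `k = 2` RUNG OF C-P2-2 FROM ONE LITERATURE DISPLAY AND GZK, AND THE DOOR
# «SHARPER ⟹ OBSERVABLE» ON `𝒮⁻` — the remaining `_of_monskyEven (hMe)` doors of the cell fed the tree theorem
# `HeathBrown1994.monsky_card_selmerGroup_two_even_holds` (Monsky's `2`-Selmer formula, even case, PROVED)

HONEST FRAMING (cell `bsd-monsky`, run/shared/lean/pub/bsd-monsky/; README §1, §3): the cell's theorem is Theorem 1.1
on `𝒮⁻`; the `k = 2` rung of C-P2-2 is RECORD («what the same argument gives», README §3); nothing is booked by this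
file. The named fact `hMe = HeathBrown1994.monsky_card_selmerGroup_two_even` (Monsky's formula
`#Sel⁽²⁾(E_D/ℚ) = 2^{2+s(D)}` for even square-free `D`, printed as «a sketch proof» in the appendix to Heath-Brown
1994) is since p509450 a THEOREM of the tree (`CongruentNumberEvenMonskySelmerExact.lean`, both halves, every number
of prime factors); Rédei–Reichardt `hR` is the tree theorem `redeiReichardt_fourTwoCard_classGroup_holds`. The
`_descent` doors (p480965 / p481286 / p485664-chain) already state C-P2-1 and the silent rung from one display alone
through the direct bound `#Sel⁽²⁾ ≤ 8`; this file adds the compositions they did not state: the WHOLE `k = 2` rung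
(silent and loud cells, `CongruentEvenBSDTwoAt 2`) and its sharper form `CongruentEvenOrdTwoAt 2` from
{`tyz_cmPointClassFieldData`, GZK} or {`tyz_cmPointGaloisData`, GZK} — U⁺ is derived from the display (TYZ Thm. 1.2
through `uPlus_of_genusPointData`), no `2`-Selmer hypothesis —, the same rung from {U⁺, GZK, `hSys′`} (route A, the
genus form of the system display), the silent rung from `hSys′` alone, and «sharper ⟹ observable» on `𝒮⁻` modulo
rank one per member only. Every declaration is a one-line composition; conclusions are unchanged; the corners of
record (referee B ROUND 375) are untouched; no mark moves. CONDITIONAL on the displayed inputs named in each binder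
list; the conjecture `Prop`s stay `@[conjecture]`; nothing asserted.
[cite: HeathBrown1994SelmerCongruentII, Appendix (Monsky), typescript p. 38 L17–L37, p. 39 L1–L41, p. 41 L1–L36]
[cite: TianYuanZhang2017, Thm. 1.2, Thm. 3.3 (p. 739), Prop. 3.2 (J738), p. 759] [cite: Tian2014, Thm. 2.8 (arXiv:1210.8231 p0011 L25–L44)]
[cite: Monsky1990MockHeegner, Remark (3) (p. 67)] [cite: SilvermanAEC2009, Thm. X.4.2] [cite: Miller2011LMS, Def. 1.1 (arXiv:1010.2431 p. 3)]
-/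

noncomputable section

open scoped Classical

open WeierstrassCurve NumberField Literature.NumberTheory.EllipticCurves
  Literature.NumberTheory.EllipticCurves.Rank1Residual
  Literature.NumberTheory.EllipticCurves.Rank1Residual.Typed
  Literature.NumberTheory.EllipticCurves.TianYuanZhang2017
  Literature.NumberTheory.EllipticCurves.HeathBrown1994
  Literature.NumberTheory.EllipticCurves.Tian2014
  Literature.NumberTheory.QuadraticFields.RedeiReichardt

set_option autoImplicit false

namespace Summit.BirchSwinnertonDyer.Rank1Residual.P2

open Conjectures

/-! ## §1 Route B: the whole `k = 2` rung and its sharper form from ONE Literature display and GZK -/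

/-- **THE `k = 2` RUNG `CongruentEvenBSDTwoAt 2` (silent AND loud cells) from {`tyz_cmPointClassFieldData`, GZK}** —
U⁺ is derived from the display, Monsky's formula is proved, nothing else is displayed. CONDITIONAL; nothing asserted.
[cite: Monsky1990MockHeegner, Remark (3) (p. 67)] [cite: TianYuanZhang2017, Thm. 1.2, Thm. 3.5, Prop. 3.2, Thm. 3.6]
[cite: HeathBrown1994SelmerCongruentII, Appendix (Monsky), typescript p. 41 L1–L36] [cite: Cox2013, Theorem 6.1 (ii) and Theorem 9.18] -/
theorem congruentEvenBSDTwoAt_two_of_cmPointClassFieldData_monskyExact (hCF : tyz_cmPointClassFieldData)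
    (hGZK : rank_eq_analyticRank_of_analyticRank_le_one) : CongruentEvenBSDTwoAt 2 :=
  congruentEvenBSDTwoAt_two_of_cmPointClassFieldData_of_monskyEven hCF hGZK
    monsky_card_selmerGroup_two_even_holds

/-- **THE `k = 2` RUNG `CongruentEvenBSDTwoAt 2` from {`tyz_cmPointGaloisData`, GZK}.** CONDITIONAL; nothing asserted.
[cite: Monsky1990MockHeegner, Remark (3) (p. 67)] [cite: TianYuanZhang2017, Thm. 1.2, Thm. 3.5, Prop. 3.2, Thm. 3.6]
[cite: HeathBrown1994SelmerCongruentII, Appendix (Monsky), typescript p. 41 L1–L36] -/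
theorem congruentEvenBSDTwoAt_two_of_cmPointGaloisData_monskyExact (hCM : tyz_cmPointGaloisData)
    (hGZK : rank_eq_analyticRank_of_analyticRank_le_one) : CongruentEvenBSDTwoAt 2 :=
  congruentEvenBSDTwoAt_two_of_cmPointGaloisData_of_monskyEven hCM hGZK monsky_card_selmerGroup_two_even_holds

/-- **THE `k = 2` RUNG, SHARPER FORM `CongruentEvenOrdTwoAt 2`, from {`tyz_cmPointClassFieldData`, GZK}** (the law's
«observable ⟹ sharper» door with the `2`-Selmer input discharged by the tree's `2`-descent). CONDITIONAL; nothing asserted.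
[cite: Monsky1990MockHeegner, Remark (3) (p. 67)] [cite: TianYuanZhang2017, Thm. 1.2, Thm. 3.3] [cite: SilvermanAEC2009, Thm. X.4.2]
[cite: Cox2013, Theorem 6.1 (ii) and Theorem 9.18] -/
theorem congruentEvenOrdTwoAt_two_of_cmPointClassFieldData_monskyExact (hCF : tyz_cmPointClassFieldData)
    (hGZK : rank_eq_analyticRank_of_analyticRank_le_one) : CongruentEvenOrdTwoAt 2 :=
  congruentEvenOrdTwoAt_of_bsdTwoAt_descent hGZK
    (congruentEvenBSDTwoAt_two_of_cmPointClassFieldData_monskyExact hCF hGZK)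

/-- **THE `k = 2` RUNG, SHARPER FORM, from {`tyz_cmPointGaloisData`, GZK}.** CONDITIONAL; nothing asserted.
[cite: Monsky1990MockHeegner, Remark (3) (p. 67)] [cite: TianYuanZhang2017, Thm. 1.2, Thm. 3.3] [cite: SilvermanAEC2009, Thm. X.4.2] -/
theorem congruentEvenOrdTwoAt_two_of_cmPointGaloisData_monskyExact (hCM : tyz_cmPointGaloisData)
    (hGZK : rank_eq_analyticRank_of_analyticRank_le_one) : CongruentEvenOrdTwoAt 2 :=
  congruentEvenOrdTwoAt_of_bsdTwoAt_descent hGZK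
    (congruentEvenBSDTwoAt_two_of_cmPointGaloisData_monskyExact hCM hGZK)

/-! ## §2 Route A: the silent rung from the genus form of the system display alone; the whole rung from {U⁺, GZK, `hSys′`} -/

/-- **THE SILENT `k = 2` RUNG from the genus system display `hSys′` ALONE** (Rédei–Reichardt and Monsky's formula both
proved; the weakest form of the system display). CONDITIONAL; nothing asserted.
[cite: Monsky1990MockHeegner, Remark (3) (p. 67)] [cite: Tian2014, Thm. 2.8 (arXiv:1210.8231 p0011 L25–L44)]
[cite: HeathBrown1994SelmerCongruentII, Appendix (Monsky), typescript p. 41 L1–L36] -/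
theorem congruentSilentEvenBSDTwoAt_two_of_genusSystem_monskyExact (hSys : tian2014_system_sMinus_genus) :
    CongruentSilentEvenBSDTwoAt 2 :=
  congruentSilentEvenBSDTwoAt_two_of_genusSystem_of_monskyEven' monsky_card_selmerGroup_two_even_holds hSys

/-- **THE `k = 2` RUNG `CongruentEvenBSDTwoAt 2` from {U⁺, GZK, `hSys′`}** (`hMe` and `hR` discharged). CONDITIONAL;
nothing asserted. [cite: Monsky1990MockHeegner, Remark (3) (p. 67)] [cite: TianYuanZhang2017, Thm. 1.2, Thm. 3.3]
[cite: Tian2014, Thm. 2.8 (arXiv:1210.8231 p0011 L25–L44)] [cite: HeathBrown1994SelmerCongruentII, Appendix (Monsky), typescript p. 41 L1–L36] -/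
theorem congruentEvenBSDTwoAt_two_of_genusSystem_monskyExact
    (hU : ∀ (n : ℕ), Squarefree n → (n % 8 = 5 ∨ n % 8 = 6 ∨ n % 8 = 7) →
      ∃ L : ℤ, IsScriptL n L ∧
        ((n % 8 = 5 ∨ n % 8 = 7) → (2 : ℤ) ∣ L →
          Even (genusSum₁ n fun d => genusClassNumber (GenusField d)) ∧
          Even (genusSum₂' n fun d => genusClassNumber (GenusField d))) ∧
        (n % 8 = 6 → (2 : ℤ) ∣ L → Even (genusSum₂' n fun d => genusClassNumber (GenusField d))))
    (hGZK : rank_eq_analyticRank_of_analyticRank_le_one) (hSys : tian2014_system_sMinus_genus) :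
    CongruentEvenBSDTwoAt 2 :=
  congruentEvenBSDTwoAt_two_of_genusSystem_of_monskyEven hU hGZK monsky_card_selmerGroup_two_even_holds
    redeiReichardt_fourTwoCard_classGroup_holds hSys

/-- **THE `k = 2` RUNG, SHARPER FORM `CongruentEvenOrdTwoAt 2`, from {U⁺, GZK, `hSys′`}.** CONDITIONAL; nothing asserted.
[cite: Monsky1990MockHeegner, Remark (3) (p. 67)] [cite: TianYuanZhang2017, Thm. 1.2, Thm. 3.3]
[cite: Tian2014, Thm. 2.8 (arXiv:1210.8231 p0011 L25–L44)] [cite: SilvermanAEC2009, Thm. X.4.2] -/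
theorem congruentEvenOrdTwoAt_two_of_genusSystem_monskyExact
    (hU : ∀ (n : ℕ), Squarefree n → (n % 8 = 5 ∨ n % 8 = 6 ∨ n % 8 = 7) →
      ∃ L : ℤ, IsScriptL n L ∧
        ((n % 8 = 5 ∨ n % 8 = 7) → (2 : ℤ) ∣ L →
          Even (genusSum₁ n fun d => genusClassNumber (GenusField d)) ∧
          Even (genusSum₂' n fun d => genusClassNumber (GenusField d))) ∧
        (n % 8 = 6 → (2 : ℤ) ∣ L → Even (genusSum₂' n fun d => genusClassNumber (GenusField d))))
    (hGZK : rank_eq_analyticRank_of_analyticRank_le_one) (hSys : tian2014_system_sMinus_genus) :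
    CongruentEvenOrdTwoAt 2 :=
  congruentEvenOrdTwoAt_two_of_genusSystem_of_monskyEven hU hGZK monsky_card_selmerGroup_two_even_holds
    redeiReichardt_fourTwoCard_classGroup_holds hSys

/-! ## §3 Sharper ⟹ observable on `𝒮⁻`, modulo rank one per member only -/

/-- **Sharper ⟹ observable on `𝒮⁻`, modulo rank one per member only**: `#Sel₂ = 8` from Monsky's formula proved and
rank `1` give `Ш[2^∞] = 0`, and the fact-free door turns `ord₂ x = 2` into `ord_{s=1} L = 1 ∧ BSD(E_{2pq}, 2)`. A kernel
implication between conjecture `Prop`s; asserts neither.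
[cite: HeathBrown1994SelmerCongruentII, Appendix (Monsky), typescript p. 41 L20–L36] [cite: SilvermanAEC2009, Thm. X.4.2]
[cite: Miller2011LMS, Def. 1.1 (arXiv:1010.2431 p. 3)] -/
theorem congruentSilentEvenFiveBSDTwo_of_ordTwo_monskyExact
    (hrank : ∀ p q : ℕ, p.Prime → q.Prime → p % 8 = 5 → q % 4 = 3 → jacobiSym p q = -1 →
      (congruentNumberCurve (2 * (p * q))).mordellWeilRank = 1)
    (h : CongruentSilentEvenFiveOrdTwo) : CongruentSilentEvenFiveBSDTwo :=
  congruentSilentEvenFiveBSDTwo_of_ordTwo_of_monskyEven monsky_card_selmerGroup_two_even_holds hrank h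

end Summit.BirchSwinnertonDyer.Rank1Residual.P2

end
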